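import Summits.ABC.ABC.Theses.IneffectiveSubspace
import Summits.ABC.ABC.Theorems.TowerFourSubLiouville.Negative.DialCalibration

/-!
# `UniformSadicTowerFour` (stmt-ABC-14937): the linear `S`-loss is forced, modulo smooth shifted primes

Negative-side calibration of the standing disprover (cycle 1, refuter-cdisprove-stmt-ABC-14937-0, 2026-08-16),
completing `Negative.SLossFloor` (exponent floor `1/2` modulo bounded prime gaps).  The crux charges a set `S`
of at most `K` primes through the factor `(∏_{p∈S} p)^{1+ε}`; replacing it by `(∏_{p∈S} p)^θ` with ANY fixed
`θ < 1` is false at budget `K = |S₀| + 1` as soon as some fixed finite set of primes `S₀` carries infinitely many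
primes `p` with `p − 1` an `S₀`-unit (`(p − 1).primeFactors ⊆ S₀`):
`uniformSadicTowerFour_sublinearSLoss_false_of_smoothShiftedPrimes`.  Witness: the `S`-unit point
`1 + (p − 1) = p` with trivial lifts and `S = insert p S₀` has `S`-free part `1`, so the right-hand side is
`C·(p·∏_{S₀} q)^{θ(1+ε)}`, sublinear in `c = p` for `ε = (1−θ)/2`.

The hypothesis is open for every `S₀` but standard: `S₀ = {2}` = infinitely many Fermat primes (believed FALSE),
`S₀ = {2, 3}` = infinitely many Pierpont primes `2^a3^b + 1` (Gleason's conjecture, believed true; heuristic count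
`≍ log N`), and it follows for some `S₀` from any quantitative conjecture on smooth shifted primes.  So the crux's
docstring claim "linear `S`-loss, forced" is exactly as safe as Pierpont primes being infinite — and no weaker
prime-distribution THEOREM forces `θ > 1/2` (see `SLossFloor`: bounded gaps give `1/2`, Baker–Harman–Pintz `0.2375`).
All statements inlined (the hypothesis is a binder, no auxiliary `def`); tool `Negative.DialCalibration.key_growth`.
-/

-- `Summit.<Summit>.<Problem>` is the mandated summit-side namespace (CONVENTIONS §2); for the
-- single-conjunct summit `ABC` the two coincide, so the duplicate `ABC.ABC` is deliberate.
set_option linter.dupNamespace false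

namespace Summit.ABC.ABC.Theorems.UniformSadicTowerFour.Negative

open scoped BigOperators
open Summit.ABC.ABC.Theses.IneffectiveSubspace
open Summit.ABC.ABC.Theorems.TowerFourSubLiouville.Negative

/-- The `S`-free part of an `S`-unit is `1`. [folklore] -/
theorem sfree_eq_one_of_subset {M : ℕ} {S : Finset ℕ} (h : M.primeFactors ⊆ S) :
    (∏ r ∈ M.primeFactors \ S, r ^ M.factorization r) = 1 := by
  rw [Finset.sdiff_eq_empty_iff_subset.mpr h, Finset.prod_empty]

/-- **The linear `S`-loss is forced, modulo smooth shifted primes.** Let `S₀` be a finite set of primes such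
that there are infinitely many primes `p` with `(p − 1).primeFactors ⊆ S₀` (for `S₀ = {2,3}`: infinitely many
Pierpont primes).  Then for every `0 ≤ θ < 1` the crux with `(∏_{p∈S} p)^θ` in place of `∏_{p∈S} p` fails at
budget `K = S₀.card + 1`: the point `1 + (p−1) = p`, `S = insert p S₀`, has `S`-free part `1` and
`p < C·(p·∏_{S₀} q)^{θ(1+ε)}` fails for large `p` once `θ(1+ε) < 1`. -/
theorem uniformSadicTowerFour_sublinearSLoss_false_of_smoothShiftedPrimes
    (S₀ : Finset ℕ) (hS₀ : ∀ q ∈ S₀, Nat.Prime q)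
    (hinf : ∀ N : ℕ, ∃ p : ℕ, N ≤ p ∧ p.Prime ∧ (p - 1).primeFactors ⊆ S₀)
    (θ : ℝ) (hθ0 : 0 ≤ θ) (hθ : θ < 1) :
    ¬ ∀ K : ℕ, ∀ ε : ℝ, 0 < ε → ∃ C : ℝ, 0 < C ∧ ∀ S : Finset ℕ, S.card ≤ K → (∀ p ∈ S, Nat.Prime p) →
      ∀ x y z : Fin 4 → ℕ, (∀ i, 0 < x i ∧ 0 < y i ∧ 0 < z i) →
      (∏ i, x i ^ (i.val + 1)) + (∏ i, y i ^ (i.val + 1)) = ∏ i, z i ^ (i.val + 1) →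
      Nat.Coprime (∏ i, x i ^ (i.val + 1)) (∏ i, y i ^ (i.val + 1)) →
      ((∏ i, z i ^ (i.val + 1) : ℕ) : ℝ) < C * ((∏ p ∈ S, (p : ℝ)) ^ θ *
        ((∏ p ∈ (∏ i, x i * y i * z i).primeFactors \ S,
          p ^ (∏ i, x i * y i * z i).factorization p : ℕ) : ℝ)) ^ (1 + ε) := by
  intro h
  set ε : ℝ := (1 - θ) / 2 with hε
  have hε0 : 0 < ε := by rw [hε]; linarith
  set s : ℝ := θ * (1 + ε) with hs
  have hs1 : s < 1 := by rw [hs, hε]; nlinarith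
  set P : ℝ := ∏ q ∈ S₀, (q : ℝ) with hP
  have hP1 : 1 ≤ P := by
    rw [hP, ← Nat.cast_prod]
    exact_mod_cast Finset.prod_pos fun q hq => (hS₀ q hq).pos
  obtain ⟨C, hC, hK⟩ := h (S₀.card + 1) ε hε0
  obtain ⟨M, hM1, hM⟩ := key_growth (K := C * P ^ s) (by positivity) hs1
  obtain ⟨N, hN⟩ := exists_nat_gt M
  obtain ⟨p, hNp, hp, hsmooth⟩ := hinf N
  obtain ⟨m, rfl⟩ : ∃ m, p = m + 1 := ⟨p - 1, by have := hp.one_lt; omega⟩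
  rw [Nat.add_sub_cancel] at hsmooth
  have hm0 : 0 < m := by have := hp.one_lt; omega
  -- the point 1 + m = m + 1 with S = insert (m+1) S₀
  have hcard : (insert (m + 1) S₀).card ≤ S₀.card + 1 := Finset.card_insert_le _ _
  have hprime : ∀ q ∈ insert (m + 1) S₀, Nat.Prime q := by
    intro q hq
    rcases Finset.mem_insert.mp hq with rfl | hq
    · exact hp
    · exact hS₀ q hq
  have key := hK (insert (m + 1) S₀) hcard hprime ![1, 1, 1, 1] ![m, 1, 1, 1] ![m + 1, 1, 1, 1]
    (by intro i; fin_cases i <;> simp [hm0])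
    (by simp [Fin.prod_univ_four]; ring) (by simp [Fin.prod_univ_four])
  have h1 : (∏ i : Fin 4, (![m + 1, 1, 1, 1] : Fin 4 → ℕ) i ^ (i.val + 1)) = m + 1 := by
    simp [Fin.prod_univ_four]
  have h2 : (∏ i : Fin 4, (![1, 1, 1, 1] : Fin 4 → ℕ) i * (![m, 1, 1, 1] : Fin 4 → ℕ) i *
      (![m + 1, 1, 1, 1] : Fin 4 → ℕ) i) = m * (m + 1) := by
    simp [Fin.prod_univ_four]
  -- the S-free part is 1
  have hsub : (m * (m + 1)).primeFactors ⊆ insert (m + 1) S₀ := by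
    rw [Nat.primeFactors_mul hm0.ne' hp.ne_zero, hp.primeFactors]
    intro r hr
    rcases Finset.mem_union.mp hr with hr | hr
    · exact Finset.mem_insert_of_mem (hsmooth hr)
    · rw [Finset.mem_singleton] at hr; rw [hr]; exact Finset.mem_insert_self _ _
  rw [h1, h2, sfree_eq_one_of_subset hsub] at key
  set p : ℕ := m + 1 with hpdef
  have hp1 : 1 ≤ p := hp.one_lt.le
  -- the S-product is at most p * P
  have hprod : (∏ q ∈ insert p S₀, (q : ℝ)) ≤ p * P := by
    by_cases hpS : p ∈ S₀
    · rw [Finset.insert_eq_of_mem hpS, ← hP]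
      have hp1' : (1 : ℝ) ≤ p := by exact_mod_cast hp1
      calc P = 1 * P := (one_mul P).symm
        _ ≤ p * P := mul_le_mul_of_nonneg_right hp1' (by linarith)
    · rw [Finset.prod_insert hpS]
  have hprod0 : (0 : ℝ) ≤ ∏ q ∈ insert p S₀, (q : ℝ) :=
    Finset.prod_nonneg fun q _ => Nat.cast_nonneg q
  have hp0 : (0 : ℝ) < p := by exact_mod_cast hp.pos
  -- RHS ≤ C * P^s * p^s
  have hrhs : C * ((∏ q ∈ insert p S₀, (q : ℝ)) ^ θ * ((1 : ℕ) : ℝ)) ^ (1 + ε) ≤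
      C * P ^ s * (p : ℝ) ^ s := by
    have h3 : (∏ q ∈ insert p S₀, (q : ℝ)) ^ θ * ((1 : ℕ) : ℝ) ≤ ((p : ℝ) * P) ^ θ := by
      rw [Nat.cast_one, mul_one]
      exact Real.rpow_le_rpow hprod0 hprod hθ0
    have h30 : (0 : ℝ) ≤ (∏ q ∈ insert p S₀, (q : ℝ)) ^ θ * ((1 : ℕ) : ℝ) := by
      rw [Nat.cast_one, mul_one]; exact Real.rpow_nonneg hprod0 _
    have h4 : ((∏ q ∈ insert p S₀, (q : ℝ)) ^ θ * ((1 : ℕ) : ℝ)) ^ (1 + ε) ≤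
        (((p : ℝ) * P) ^ θ) ^ (1 + ε) := Real.rpow_le_rpow h30 h3 (by linarith)
    have h5 : (((p : ℝ) * P) ^ θ) ^ (1 + ε) = P ^ s * (p : ℝ) ^ s := by
      rw [← Real.rpow_mul (by positivity), ← hs, Real.mul_rpow hp0.le (by linarith)]
      ring
    calc C * ((∏ q ∈ insert p S₀, (q : ℝ)) ^ θ * ((1 : ℕ) : ℝ)) ^ (1 + ε)
        ≤ C * (((p : ℝ) * P) ^ θ) ^ (1 + ε) := mul_le_mul_of_nonneg_left h4 hC.le
      _ = C * P ^ s * (p : ℝ) ^ s := by rw [h5]; ring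
  have hMp : M ≤ (p : ℝ) := hN.le.trans (by exact_mod_cast hNp)
  have hgrow := hM (p : ℝ) hMp
  have hkey : ((p : ℕ) : ℝ) < C * ((∏ q ∈ insert p S₀, (q : ℝ)) ^ θ * ((1 : ℕ) : ℝ)) ^ (1 + ε) := key
  linarith

end Summit.ABC.ABC.Theorems.UniformSadicTowerFour.Negative
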